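import Mathlib
import HarnessLib

/-!
# The cubic BLOCK LEMMA: a bounded observer of a coin block cannot track an order-3 register character
# («sparse register reads are private noise»; typed and proved by the cell qa-qnc0, planner p2 g33, ROUND-33 §9.4 (F2);
# vendored verbatim as a Literature tool, namespace renamed)

A ±1-valued (more generally `[-1,1]`-valued) Boolean observer of a block of fair coins cannot track an
order-3 character of a register fed by one of those coins:

* `normSq_cubic` — for `ω : ℂ` with `ω² + ω + 1 = 0` and real `a₀ a₁ a₂`,
  `‖a₀ + a₁ω + a₂ω²‖² = a₀² + a₁² + a₂² − a₀a₁ − a₀a₂ − a₁a₂`.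
* `cubicForm_le` — if `|a_t| ≤ P_t`, `0 ≤ P_t ≤ 1/2`, `P₀ + P₁ + P₂ = 1` then that form is `≤ 3/4`
  (proof: `½Σ(a_i−a_j)² ≤ ½Σ(P_i+P_j)² = (1 + ΣP_t²)/2 ≤ 3/4`).
* `norm_cubic_le` — hence `‖a₀ + a₁ω + a₂ω²‖ ≤ √3/2`.
* `card_filter_blockSum_le` — on the cube `Fin w → Bool`, if `γ i₀ ≠ 0` then every residue class of
  `T(x) = Σ_j [x_j] γ_j ∈ ZMod 3` has at most half of the points (flip coordinate `i₀`).
* `blockLemma` — for every observer `ε : (Fin w → Bool) → ℝ` with `|ε x| ≤ 1`: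
  `‖Σ_x ε(x) ω^{T(x)}‖ ≤ (√3/2) · 2^w`.
* `blockLemma_prod` — `m` separated blocks with block-local observers: `≤ (√3/2)^m · Π 2^{w_i}`.

Mathlib only (no project imports).  Printed relatives: the scalar two-moduli factors of
[GreenRoyStraubing2005, §2] / Bourgain 2005 (`|1 + ω^a e(·)|`-type bounds); this coin-block form is not located in
print and is SUPPLIED HERE (consumer: qa-qnc0 ROUND-33 §9.4, ROUND-35 pair slicing).  No named facts.
-/

namespace Literature.Computability.MetaComplexity.CubicBlock

open Finset

/-! ## The cubic character norm -/

/-- `ω³ = 1`. [folklore] -/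
private theorem omega_cube (ω : ℂ) (hω : ω ^ 2 + ω + 1 = 0) : ω ^ 3 = 1 := by
  linear_combination (ω - 1) * hω

/-- `ω ≠ 1`. [folklore] -/
private theorem omega_ne_one (ω : ℂ) (hω : ω ^ 2 + ω + 1 = 0) : ω ≠ 1 := by
  rintro rfl; norm_num at hω

/-- The conjugate character: `ω²` is a primitive cube root of unity as well (apply `blockLemma` to it
for the exponent `2T = −T`). [cite: GreenRoyStraubing2005, §2 (scalar two-moduli factors of this type); this form supplied here (qa-qnc0 ROUND-33 §9.4)] -/
theorem omega_sq_root (ω : ℂ) (hω : ω ^ 2 + ω + 1 = 0) : (ω ^ 2) ^ 2 + ω ^ 2 + 1 = 0 := by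
  linear_combination (ω ^ 2 - ω + 1) * hω

/-- `conj ω = ω²`: both are the inverse of `ω` on the unit circle. [cite: GreenRoyStraubing2005, §2 (scalar two-moduli factors of this type); this form supplied here (qa-qnc0 ROUND-33 §9.4)] -/
theorem conj_omega (ω : ℂ) (hω : ω ^ 2 + ω + 1 = 0) : (starRingEnd ℂ) ω = ω ^ 2 := by
  -- ω is a primitive cube root of unity: ω = exp(±2πi/3); we argue algebraically:
  -- normSq ω = 1 because ω³ = 1 gives ‖ω‖³ = 1.
  have h3 := omega_cube ω hω
  have hn : ‖ω‖ = 1 := by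
    have : ‖ω‖ ^ 3 = 1 := by rw [← norm_pow, h3, norm_one]
    have h0 : 0 ≤ ‖ω‖ := norm_nonneg _
    nlinarith [this, h0, sq_nonneg (‖ω‖ - 1), sq_nonneg ‖ω‖]
  have hns : Complex.normSq ω = 1 := by
    rw [Complex.normSq_eq_norm_sq, hn]; norm_num
  -- conj ω * ω = 1 and ω² * ω = 1 ⇒ conj ω = ω²
  have h1 : (starRingEnd ℂ) ω * ω = 1 := by
    rw [← Complex.normSq_eq_conj_mul_self, hns]; simp
  have h2 : ω ^ 2 * ω = 1 := by rw [← pow_succ, h3]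
  have hω0 : ω ≠ 0 := by rintro rfl; norm_num at hω
  exact mul_right_cancel₀ hω0 (h1.trans h2.symm)

/-- `‖a₀ + a₁ω + a₂ω²‖² = a₀² + a₁² + a₂² − a₀a₁ − a₀a₂ − a₁a₂` for real coefficients. [cite: GreenRoyStraubing2005, §2 (scalar two-moduli factors of this type); this form supplied here (qa-qnc0 ROUND-33 §9.4)] -/
theorem normSq_cubic (ω : ℂ) (hω : ω ^ 2 + ω + 1 = 0) (a₀ a₁ a₂ : ℝ) :
    Complex.normSq ((a₀ : ℂ) + a₁ * ω + a₂ * ω ^ 2) =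
      a₀ ^ 2 + a₁ ^ 2 + a₂ ^ 2 - a₀ * a₁ - a₀ * a₂ - a₁ * a₂ := by
  have h3 := omega_cube ω hω
  have hc := conj_omega ω hω
  -- normSq z = conj z * z, computed in ℂ and compared via ofReal injectivity
  have key : ((Complex.normSq ((a₀ : ℂ) + a₁ * ω + a₂ * ω ^ 2) : ℝ) : ℂ) =
      ((a₀ ^ 2 + a₁ ^ 2 + a₂ ^ 2 - a₀ * a₁ - a₀ * a₂ - a₁ * a₂ : ℝ) : ℂ) := by
    rw [Complex.normSq_eq_conj_mul_self]
    simp only [map_add, map_mul, Complex.conj_ofReal, map_pow, hc]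
    push_cast
    linear_combination ((a₁ : ℂ) ^ 2 * (ω - 1) + (a₂ : ℂ) ^ 2 * (ω - 1) * (ω ^ 3 + 1) + (a₀ : ℂ) * a₁
      + (a₀ : ℂ) * a₂ * (ω ^ 2 - ω + 1) + (a₁ : ℂ) * a₂ * (ω ^ 3 - ω + 1)) * hω
  exact_mod_cast key

/-- The real core: the cubic form is at most `3/4` on the box `|a_t| ≤ P_t` when `P` is a probability
vector with all entries `≤ 1/2`. [cite: GreenRoyStraubing2005, §2 (scalar two-moduli factors of this type); this form supplied here (qa-qnc0 ROUND-33 §9.4)] -/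
theorem cubicForm_le (a₀ a₁ a₂ P₀ P₁ P₂ : ℝ) (h₀ : |a₀| ≤ P₀) (h₁ : |a₁| ≤ P₁) (h₂ : |a₂| ≤ P₂)
    (hP₀ : P₀ ≤ 1 / 2) (hP₁ : P₁ ≤ 1 / 2) (hP₂ : P₂ ≤ 1 / 2) (hsum : P₀ + P₁ + P₂ = 1) :
    a₀ ^ 2 + a₁ ^ 2 + a₂ ^ 2 - a₀ * a₁ - a₀ * a₂ - a₁ * a₂ ≤ 3 / 4 := by
  have g₀ : 0 ≤ P₀ := (abs_nonneg _).trans h₀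
  have g₁ : 0 ≤ P₁ := (abs_nonneg _).trans h₁
  have g₂ : 0 ≤ P₂ := (abs_nonneg _).trans h₂
  have d01 : (a₀ - a₁) ^ 2 ≤ (P₀ + P₁) ^ 2 := by
    have h : |a₀ - a₁| ≤ P₀ + P₁ := (abs_sub _ _).trans (add_le_add h₀ h₁)
    have := pow_le_pow_left₀ (abs_nonneg _) h 2
    rwa [sq_abs] at this
  have d02 : (a₀ - a₂) ^ 2 ≤ (P₀ + P₂) ^ 2 := by
    have h : |a₀ - a₂| ≤ P₀ + P₂ := (abs_sub _ _).trans (add_le_add h₀ h₂)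
    have := pow_le_pow_left₀ (abs_nonneg _) h 2
    rwa [sq_abs] at this
  have d12 : (a₁ - a₂) ^ 2 ≤ (P₁ + P₂) ^ 2 := by
    have h : |a₁ - a₂| ≤ P₁ + P₂ := (abs_sub _ _).trans (add_le_add h₁ h₂)
    have := pow_le_pow_left₀ (abs_nonneg _) h 2
    rwa [sq_abs] at this
  have e₀ : P₀ * P₀ ≤ P₀ * (1 / 2) := mul_le_mul_of_nonneg_left hP₀ g₀
  have e₁ : P₁ * P₁ ≤ P₁ * (1 / 2) := mul_le_mul_of_nonneg_left hP₁ g₁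
  have e₂ : P₂ * P₂ ≤ P₂ * (1 / 2) := mul_le_mul_of_nonneg_left hP₂ g₂
  have hs : (P₀ + P₁ + P₂) ^ 2 = 1 := by rw [hsum]; norm_num
  nlinarith [d01, d02, d12, e₀, e₁, e₂, hs, hsum]

/-- `‖a₀ + a₁ω + a₂ω²‖ ≤ √3/2` under the hypotheses of `cubicForm_le`. [cite: GreenRoyStraubing2005, §2 (scalar two-moduli factors of this type); this form supplied here (qa-qnc0 ROUND-33 §9.4)] -/
theorem norm_cubic_le (ω : ℂ) (hω : ω ^ 2 + ω + 1 = 0) (a₀ a₁ a₂ P₀ P₁ P₂ : ℝ)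
    (h₀ : |a₀| ≤ P₀) (h₁ : |a₁| ≤ P₁) (h₂ : |a₂| ≤ P₂)
    (hP₀ : P₀ ≤ 1 / 2) (hP₁ : P₁ ≤ 1 / 2) (hP₂ : P₂ ≤ 1 / 2) (hsum : P₀ + P₁ + P₂ = 1) :
    ‖(a₀ : ℂ) + a₁ * ω + a₂ * ω ^ 2‖ ≤ Real.sqrt 3 / 2 := by
  have hq := cubicForm_le a₀ a₁ a₂ P₀ P₁ P₂ h₀ h₁ h₂ hP₀ hP₁ hP₂ hsum
  have hns : ‖(a₀ : ℂ) + a₁ * ω + a₂ * ω ^ 2‖ ^ 2 ≤ 3 / 4 := by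
    rw [← Complex.normSq_eq_norm_sq, normSq_cubic ω hω]; exact hq
  have h0 : 0 ≤ ‖(a₀ : ℂ) + a₁ * ω + a₂ * ω ^ 2‖ := norm_nonneg _
  have h4 : Real.sqrt 4 = 2 := by
    rw [show (4 : ℝ) = 2 ^ 2 by norm_num, Real.sqrt_sq (by norm_num : (0 : ℝ) ≤ 2)]
  have hs : Real.sqrt (3 / 4) = Real.sqrt 3 / 2 := by
    rw [Real.sqrt_div (by norm_num : (0 : ℝ) ≤ 3), h4]
  calc ‖(a₀ : ℂ) + a₁ * ω + a₂ * ω ^ 2‖ = Real.sqrt (‖(a₀ : ℂ) + a₁ * ω + a₂ * ω ^ 2‖ ^ 2) :=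
        (Real.sqrt_sq h0).symm
    _ ≤ Real.sqrt (3 / 4) := Real.sqrt_le_sqrt hns
    _ = Real.sqrt 3 / 2 := hs

/-! ## The Boolean cube: residue classes of a block sum are at most half -/

/-- The register increment contributed by a block of coins: `T(x) = Σ_j [x_j] γ_j ∈ ℤ/3`. [cite: GreenRoyStraubing2005, §2 (scalar two-moduli factors of this type); this form supplied here (qa-qnc0 ROUND-33 §9.4)] -/
def blockSum {w : ℕ} (γ : Fin w → ZMod 3) (x : Fin w → Bool) : ZMod 3 :=
  ∑ j, if x j then γ j else 0

/-- Flipping coin `i₀` changes the block sum by `±γ_{i₀}`. [cite: GreenRoyStraubing2005, §2 (scalar two-moduli factors of this type); this form supplied here (qa-qnc0 ROUND-33 §9.4)] -/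
theorem blockSum_update {w : ℕ} (γ : Fin w → ZMod 3) (x : Fin w → Bool) (i₀ : Fin w) (b : Bool) :
    blockSum γ (Function.update x i₀ b) + (if x i₀ then γ i₀ else 0) =
      blockSum γ x + (if b then γ i₀ else 0) := by
  unfold blockSum
  rw [← Finset.add_sum_erase _ _ (Finset.mem_univ i₀),
    ← Finset.add_sum_erase (Finset.univ) (fun j => if x j then γ j else 0) (Finset.mem_univ i₀)]
  have hrest : ∑ j ∈ Finset.univ.erase i₀, (if Function.update x i₀ b j then γ j else 0) =
      ∑ j ∈ Finset.univ.erase i₀, (if x j then γ j else 0) := by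
    apply Finset.sum_congr rfl
    intro j hj
    rw [Function.update_of_ne (Finset.ne_of_mem_erase hj)]
  rw [hrest, Function.update_self]
  ring

/-- The flip of coin `i₀` moves every point of a residue class of `T` out of that class (`γ_{i₀} ≠ 0`). [cite: GreenRoyStraubing2005, §2 (scalar two-moduli factors of this type); this form supplied here (qa-qnc0 ROUND-33 §9.4)] -/
theorem blockSum_flip_ne {w : ℕ} (γ : Fin w → ZMod 3) (i₀ : Fin w) (hγ : γ i₀ ≠ 0)
    (x : Fin w → Bool) : blockSum γ (Function.update x i₀ (!x i₀)) ≠ blockSum γ x := by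
  have h := blockSum_update γ x i₀ (!x i₀)
  intro heq
  rw [heq] at h
  have : (if x i₀ then γ i₀ else 0) = (if (!x i₀) then γ i₀ else 0) := add_left_cancel h
  cases hx : x i₀ <;> simp [hx] at this <;> first | exact hγ this | exact hγ this.symm

/-- Every residue class of the block sum has at most half of the cube, provided some `γ_{i₀} ≠ 0`. [cite: GreenRoyStraubing2005, §2 (scalar two-moduli factors of this type); this form supplied here (qa-qnc0 ROUND-33 §9.4)] -/
theorem two_mul_card_filter_blockSum_le {w : ℕ} (γ : Fin w → ZMod 3) (i₀ : Fin w) (hγ : γ i₀ ≠ 0)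
    (t : ZMod 3) :
    2 * ((Finset.univ.filter fun x : Fin w → Bool => blockSum γ x = t).card) ≤ 2 ^ w := by
  classical
  set A := Finset.univ.filter fun x : Fin w → Bool => blockSum γ x = t with hA
  let φ : (Fin w → Bool) → (Fin w → Bool) := fun x => Function.update x i₀ (!x i₀)
  have hφφ : ∀ x, φ (φ x) = x := by
    intro x; funext j
    by_cases hj : j = i₀
    · subst hj; simp [φ]
    · simp [φ, Function.update_of_ne hj]
  have hmaps : ∀ x ∈ A, φ x ∈ Aᶜ := by
    intro x hx
    rw [Finset.mem_compl]
    intro hx'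
    rw [hA, Finset.mem_filter] at hx hx'
    exact blockSum_flip_ne γ i₀ hγ x (hx'.2.trans hx.2.symm)
  have hinj : Set.InjOn φ A := by
    intro x _ y _ hxy
    have := congrArg φ hxy
    rwa [hφφ, hφφ] at this
  have hle : A.card ≤ Aᶜ.card := Finset.card_le_card_of_injOn φ hmaps hinj
  have hc : Aᶜ.card = 2 ^ w - A.card := by
    rw [Finset.card_compl, Fintype.card_fun, Fintype.card_bool, Fintype.card_fin]
  have hAle : A.card ≤ 2 ^ w := by
    calc A.card ≤ (Finset.univ : Finset (Fin w → Bool)).card := Finset.card_le_univ _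
      _ = 2 ^ w := by rw [Finset.card_univ, Fintype.card_fun, Fintype.card_bool, Fintype.card_fin]
  omega

/-! ## The block lemma -/

/-- **BLOCK LEMMA.** For a block of `w` fair coins feeding a `ℤ/3` register through `γ` with some
`γ_{i₀} ≠ 0`, every `[-1,1]`-valued observer `ε` of the coins satisfies
`‖Σ_x ε(x) ω^{T(x)}‖ ≤ (√3/2)·2^w` (`ω` any primitive cube root of unity, `T` the block sum).
Equivalently `|E[ε ω^{T}]| ≤ √3/2`: a Boolean junta cannot track an order-3 character. [cite: GreenRoyStraubing2005, §2 (scalar two-moduli factors of this type); this form supplied here (qa-qnc0 ROUND-33 §9.4)] -/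
theorem blockLemma {w : ℕ} (γ : Fin w → ZMod 3) (i₀ : Fin w) (hγ : γ i₀ ≠ 0)
    (ε : (Fin w → Bool) → ℝ) (hε : ∀ x, |ε x| ≤ 1) (ω : ℂ) (hω : ω ^ 2 + ω + 1 = 0) :
    ‖∑ x : Fin w → Bool, (ε x : ℂ) * ω ^ (blockSum γ x).val‖ ≤ Real.sqrt 3 / 2 * 2 ^ w := by
  classical
  -- group the sum by the value of the block sum
  set A : ZMod 3 → Finset (Fin w → Bool) := fun t => Finset.univ.filter fun x => blockSum γ x = t
    with hA
  set a : ZMod 3 → ℝ := fun t => ∑ x ∈ A t, ε x with ha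
  have hgroup : ∑ x : Fin w → Bool, (ε x : ℂ) * ω ^ (blockSum γ x).val =
      ∑ t : ZMod 3, (a t : ℂ) * ω ^ t.val := by
    rw [← Finset.sum_fiberwise_of_maps_to (s := Finset.univ) (t := (Finset.univ : Finset (ZMod 3)))
      (g := fun x => blockSum γ x) (fun x _ => Finset.mem_univ _)]
    apply Finset.sum_congr rfl
    intro t _
    rw [ha]; dsimp only
    push_cast
    rw [Finset.sum_mul]
    apply Finset.sum_congr rfl
    intro x hx
    rw [Finset.mem_filter] at hx
    rw [hx.2]
  have hsum3 : ∑ t : ZMod 3, (a t : ℂ) * ω ^ t.val = (a 0 : ℂ) + a 1 * ω + a 2 * ω ^ 2 := by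
    rw [show (∑ t : ZMod 3, (a t : ℂ) * ω ^ t.val) = ∑ t : Fin 3, (a t : ℂ) * ω ^ t.val from rfl,
      Fin.sum_univ_three]
    simp only [Fin.val_zero, Fin.val_one, Fin.val_two, pow_zero, pow_one, mul_one]
    rfl
  -- the probability vector P_t = |A_t| / 2^w
  have hN : (0 : ℝ) < 2 ^ w := by positivity
  have hcardsum : ∑ t : ZMod 3, ((A t).card : ℝ) = 2 ^ w := by
    have h := Finset.card_eq_sum_card_fiberwise (s := (Finset.univ : Finset (Fin w → Bool)))
      (t := (Finset.univ : Finset (ZMod 3))) (f := fun x => blockSum γ x) (fun x _ => Finset.mem_univ _)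
    rw [Finset.card_univ, Fintype.card_fun, Fintype.card_bool, Fintype.card_fin] at h
    have : ((2 ^ w : ℕ) : ℝ) = ∑ t : ZMod 3, ((A t).card : ℝ) := by rw [h]; push_cast; rfl
    rw [← this]; push_cast; ring
  have hPhalf : ∀ t, ((A t).card : ℝ) / 2 ^ w ≤ 1 / 2 := by
    intro t
    have h := two_mul_card_filter_blockSum_le γ i₀ hγ t
    rw [div_le_iff₀ hN]
    have : (2 : ℝ) * (A t).card ≤ 2 ^ w := by exact_mod_cast h
    linarith
  have habs : ∀ t, |a t / 2 ^ w| ≤ ((A t).card : ℝ) / 2 ^ w := by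
    intro t
    rw [abs_div, abs_of_pos hN]
    apply div_le_div_of_nonneg_right _ hN.le
    calc |a t| = |∑ x ∈ A t, ε x| := rfl
      _ ≤ ∑ x ∈ A t, |ε x| := Finset.abs_sum_le_sum_abs _ _
      _ ≤ ∑ x ∈ A t, (1 : ℝ) := Finset.sum_le_sum fun x _ => hε x
      _ = (A t).card := by simp
  have hsum1 : ((A 0).card : ℝ) / 2 ^ w + ((A 1).card : ℝ) / 2 ^ w + ((A 2).card : ℝ) / 2 ^ w = 1 := by
    rw [← add_div, ← add_div, div_eq_one_iff_eq hN.ne']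
    have : ∑ t : ZMod 3, ((A t).card : ℝ) = ((A 0).card : ℝ) + (A 1).card + (A 2).card := by
      rw [show (∑ t : ZMod 3, ((A t).card : ℝ)) = ∑ t : Fin 3, ((A t).card : ℝ) from rfl,
        Fin.sum_univ_three]; rfl
    rw [← this, hcardsum]
  have hcore := norm_cubic_le ω hω (a 0 / 2 ^ w) (a 1 / 2 ^ w) (a 2 / 2 ^ w)
    (((A 0).card : ℝ) / 2 ^ w) (((A 1).card : ℝ) / 2 ^ w) (((A 2).card : ℝ) / 2 ^ w)
    (habs 0) (habs 1) (habs 2) (hPhalf 0) (hPhalf 1) (hPhalf 2) hsum1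
  -- rescale
  have hscale : (a 0 : ℂ) + a 1 * ω + a 2 * ω ^ 2 =
      (2 ^ w : ℂ) * (((a 0 / 2 ^ w : ℝ) : ℂ) + ((a 1 / 2 ^ w : ℝ) : ℂ) * ω + ((a 2 / 2 ^ w : ℝ) : ℂ) * ω ^ 2) := by
    push_cast
    field_simp
  rw [hgroup, hsum3, hscale, norm_mul]
  have h2 : ‖(2 ^ w : ℂ)‖ = 2 ^ w := by simp
  rw [h2]
  calc (2 : ℝ) ^ w * ‖(((a 0 / 2 ^ w : ℝ) : ℂ) + ((a 1 / 2 ^ w : ℝ) : ℂ) * ω + ((a 2 / 2 ^ w : ℝ) : ℂ) * ω ^ 2)‖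
      ≤ 2 ^ w * (Real.sqrt 3 / 2) := mul_le_mul_of_nonneg_left hcore hN.le
    _ = Real.sqrt 3 / 2 * 2 ^ w := by ring


/-! ## Separated blocks multiply: the `(√3/2)^m` decorrelation -/

/-- **PRODUCT FORM.** `m` disjoint blocks (block `i` has `w i` coins and feeds the register through
`γ i` with `γ i (j₀ i) ≠ 0`), block-local observers `ε i` with `|ε i y| ≤ 1`; then
`‖Σ_x Π_i ε_i(x_i) · ω^{Σ_i T_i(x_i)}‖ ≤ (√3/2)^m · Π_i 2^{w i}`.  This is the shape the peeling
argument produces after conditioning on the strips between fresh cores (ROUND-33 §9.4 (F2)). [cite: GreenRoyStraubing2005, §2 (scalar two-moduli factors of this type); this form supplied here (qa-qnc0 ROUND-33 §9.4)] -/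
theorem blockLemma_prod {m : ℕ} (w : Fin m → ℕ) (γ : (i : Fin m) → Fin (w i) → ZMod 3)
    (j₀ : (i : Fin m) → Fin (w i)) (hγ : ∀ i, γ i (j₀ i) ≠ 0)
    (ε : (i : Fin m) → (Fin (w i) → Bool) → ℝ) (hε : ∀ i y, |ε i y| ≤ 1)
    (ω : ℂ) (hω : ω ^ 2 + ω + 1 = 0) :
    ‖∑ x : (i : Fin m) → (Fin (w i) → Bool),
        (∏ i, (ε i (x i) : ℂ)) * ω ^ (∑ i, (blockSum (γ i) (x i)).val)‖
      ≤ (Real.sqrt 3 / 2) ^ m * ∏ i, (2 : ℝ) ^ (w i) := by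
  classical
  set g : (i : Fin m) → (Fin (w i) → Bool) → ℂ :=
    fun i y => (ε i y : ℂ) * ω ^ (blockSum (γ i) y).val with hg
  -- ω^{Σ val} = Π ω^{val}
  have hfac : ∀ x : (i : Fin m) → (Fin (w i) → Bool),
      (∏ i, (ε i (x i) : ℂ)) * ω ^ (∑ i, (blockSum (γ i) (x i)).val) = ∏ i, g i (x i) := by
    intro x
    simp only [hg]
    rw [Finset.prod_mul_distrib, Finset.prod_pow_eq_pow_sum]
  simp_rw [hfac]
  -- Fubini over the product cube
  have hfub : ∑ x : (i : Fin m) → (Fin (w i) → Bool), ∏ i, g i (x i) = ∏ i, ∑ y, g i y := by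
    rw [Finset.prod_univ_sum, Fintype.piFinset_univ]
  have hconst : (Real.sqrt 3 / 2) ^ m * ∏ i, (2 : ℝ) ^ (w i) =
      ∏ i : Fin m, (Real.sqrt 3 / 2 * (2 : ℝ) ^ (w i)) := by
    rw [Finset.prod_mul_distrib, Finset.prod_const, Finset.card_univ, Fintype.card_fin]
  rw [hfub, norm_prod, hconst]
  apply Finset.prod_le_prod (fun i _ => norm_nonneg _)
  intro i _
  simp only [hg]
  exact blockLemma (γ i) (j₀ i) (hγ i) (ε i) (hε i) ω hω

end Literature.Computability.MetaComplexity.CubicBlock
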